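import Summits.NavierStokesRegularity.NavierStokesRegularity.Theorems.RungBlowupCofinal.ConvectiveLiftLetters
import HarnessLib

/-!
# The zonal ROLL–STREAK letters: the `j = 1` poloidal zonal lift `R = A(‖y‖²)e₃ + B(‖y‖²)y₂·y`
# (rolls / meridional circulation) against the zonal swirl `V = Ω(‖y‖²)e₃ × y` (streak) —
# LIFT-UP `(R·∇)V + (V·∇)R = 2y₂(ΩB + Ω′(A + B‖y‖²))·e₃ × y` and the roll self-advection
# (route `AngularGalerkinLadder`, crux K1 `RungBlowupCofinal`; kinematic helper, theorems only)

Cell `ns-blowup`, seat `ns-blowup-circuit` (g12, AGL Lean seat). Helper file for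
`stmt-NavierStokesRegularity-19959`, line `Cruxes/RungBlowupCofinal/Lines/qlwave.lean`, card support
target **(S5)** (nonlinear letters of the mean–wave system) — the ZONAL × ZONAL products, closing
the kinematic SSP triad of the card's `## Transfer` next to `swirl_wave_coupling`
(`ConvectiveLiftLetters`: streak × wave) and `sectoralThreeLift_selfAdvection_sum`
(`SectoralReynoldsStressFull`: wave × wave ↦ rolls + streak forcing).

The simplest zonal POLOIDAL field is the radially modulated lift of the zonal solid harmonic
`z₁ = y₂`: `R(y) = A(‖y‖²)∇z₁ + B(‖y‖²)z₁·y = A(‖y‖²)e₃ + B(‖y‖²)y₂·y` ("rolls": an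
axisymmetric meridional circulation; `J₃R = 0`, `angGen_two_roll`). Against the zonal swirl
`V(y) = Ω(‖y‖²)e₃ × y` ("streak", the toroidal lift of `z₁`):

* **`roll_streak_liftUp`**: `(V·∇)R + (R·∇)V = 2y₂·(Ω B + Ω′·(A + B‖y‖²))·e₃ × y` — rolls
  acting on the swirl feed the `j = 2` TOROIDAL zonal harmonic `y₂·e₃ × y` (differential rotation,
  the toroidal lift of `z₂`): the LIFT-UP step of the self-sustaining-process dictionary, in this
  geometry and in closed form (from `swirl_wave_coupling` with `W := R` and `J₃R = 0`);
* **`roll_selfAdvection`**: `(R·∇)R = y₂(2A′(A + B‖y‖²) + AB)·e₃ + (2B′y₂²(A + B‖y‖²) + AB + 2B²y₂²)·y`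
  — zonal and poloidal again (harmonics `j ≤ 2`).

LABEL: KERNEL kinematics. Nothing here asserts a Theses declaration; no definition, no named fact,
no sorry. WHAT THIS IS NOT: not Navier–Stokes evidence; no profile is constructed or excluded; the
zonal linear operator (radial ODEs) and pressures are untouched. References:
[cite: BullardGellman1954] (poloidal/toroidal lifts of zonal harmonics);
[cite: MajdaBertozziCUP2002, §1.1].
-/

noncomputable section

namespace Summit.NavierStokesRegularity.AngularGalerkinLadderZonalRollStreakLetters

open Set Function
open scoped ContDiff RealInnerProductSpace
open Literature.Analysis.FluidPDE
open Summit.NavierStokesRegularity.FluidComputer Summit.NavierStokesRegularity.FluidComputer.AngularLadder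
open Summit.NavierStokesRegularity.AngularGalerkinLadderConvectiveLiftLetters

variable {A B Ω : ℝ → ℝ}

/-! ## §1 Small coordinate facts -/

/-- `⟪y, e₃⟫ = y₂`. [folklore] -/
private theorem inner_axis_two (y : EuclideanSpace ℝ (Fin 3)) : ⟪y, axis 2⟫ = y 2 := by
  simp [axis, PiLp.inner_apply]

/-- `(e₃)₂ = 1`. [folklore] -/
private theorem axis_two_apply_two : (axis 2 : EuclideanSpace ℝ (Fin 3)) 2 = 1 := by
  simp [axis]

/-- `(e₃ × w)₂ = 0`. [folklore] -/
private theorem cross_axis_two_apply_two (w : EuclideanSpace ℝ (Fin 3)) :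
    cross (axis 2) w 2 = 0 := by
  simp [axis, cross, cross_apply]

/-- `e₃ × (v + w) = e₃ × v + e₃ × w`. [folklore] -/
private theorem cross_axis_add (v w : EuclideanSpace ℝ (Fin 3)) :
    cross (axis 2) (v + w) = cross (axis 2) v + cross (axis 2) w := by
  rw [← crossCLM_apply, map_add, crossCLM_apply, crossCLM_apply]

/-- `e₃ × (c v) = c (e₃ × v)`. [folklore] -/
private theorem cross_axis_smul (c : ℝ) (v : EuclideanSpace ℝ (Fin 3)) :
    cross (axis 2) (c • v) = c • cross (axis 2) v := by
  rw [← crossCLM_apply, map_smul, crossCLM_apply]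

/-- `e₃ × e₃ = 0`. [folklore] -/
private theorem cross_axis_self :
    cross (axis 2 : EuclideanSpace ℝ (Fin 3)) (axis 2) = 0 := by
  ext i
  fin_cases i <;> simp [axis, cross]

/-- `⟪y, e₃ × y⟫ = 0`. [folklore] -/
private theorem inner_self_cross_axis (y : EuclideanSpace ℝ (Fin 3)) :
    ⟪y, cross (axis 2) y⟫ = 0 := by
  simp [axis, cross, cross_apply, PiLp.inner_apply, Fin.sum_univ_three]
  ring

/-- The derivative of a radial profile: `D(c(‖·‖²))(y) w = c′(‖y‖²) · 2⟪y, w⟫`. [folklore] -/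
private theorem fderiv_radial_apply'' {c : ℝ → ℝ} (hc : Differentiable ℝ c)
    (y w : EuclideanSpace ℝ (Fin 3)) :
    fderiv ℝ (fun x : EuclideanSpace ℝ (Fin 3) => c (‖x‖ ^ 2)) y w =
      deriv c (‖y‖ ^ 2) * (2 * ⟪y, w⟫) := by
  have h : HasFDerivAt (fun x : EuclideanSpace ℝ (Fin 3) => c (‖x‖ ^ 2))
      (deriv c (‖y‖ ^ 2) • (2 : ℕ) • innerSL ℝ y) y :=
    ((hc (‖y‖ ^ 2)).hasDerivAt).comp_hasFDerivAt y (hasStrictFDerivAt_norm_sq y).hasFDerivAt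
  rw [h.fderiv]
  simp

/-- A radial profile is differentiable as a function on `ℝ³`. [folklore] -/
private theorem differentiableAt_radial'' {c : ℝ → ℝ} (hc : Differentiable ℝ c)
    (y : EuclideanSpace ℝ (Fin 3)) :
    DifferentiableAt ℝ (fun x : EuclideanSpace ℝ (Fin 3) => c (‖x‖ ^ 2)) y :=
  (hc (‖y‖ ^ 2)).comp y ((hasStrictFDerivAt_norm_sq y).hasFDerivAt.differentiableAt)

/-! ## §2 The roll field `R = A(‖y‖²)e₃ + B(‖y‖²)y₂·y` and its derivative -/

/-- **The derivative of the roll field**: for `R(y) = A(‖y‖²)e₃ + (B(‖y‖²)y₂)·y`,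
`DR(y) w = 2A′⟪y,w⟫·e₃ + (2B′⟪y,w⟫y₂ + B w₂)·y + B y₂·w`. [folklore] -/
theorem fderiv_roll_apply (hA : Differentiable ℝ A) (hB : Differentiable ℝ B)
    (y w : EuclideanSpace ℝ (Fin 3)) :
    fderiv ℝ (fun x : EuclideanSpace ℝ (Fin 3) =>
        A (‖x‖ ^ 2) • (axis 2 : EuclideanSpace ℝ (Fin 3)) + (B (‖x‖ ^ 2) * x 2) • x) y w =
      (deriv A (‖y‖ ^ 2) * (2 * ⟪y, w⟫)) • (axis 2 : EuclideanSpace ℝ (Fin 3)) +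
        (deriv B (‖y‖ ^ 2) * (2 * ⟪y, w⟫) * y 2 + B (‖y‖ ^ 2) * w 2) • y +
        (B (‖y‖ ^ 2) * y 2) • w := by
  -- the coordinate `x ↦ x 2` is the continuous linear map `EuclideanSpace.proj 2`
  have hπd : DifferentiableAt ℝ (fun x : EuclideanSpace ℝ (Fin 3) => x 2) y :=
    (EuclideanSpace.proj (2 : Fin 3) : EuclideanSpace ℝ (Fin 3) →L[ℝ] ℝ).differentiableAt
  have hπf : ∀ v, fderiv ℝ (fun x : EuclideanSpace ℝ (Fin 3) => x 2) y v = v 2 := fun v => by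
    rw [show (fun x : EuclideanSpace ℝ (Fin 3) => x 2) =
      fun x => (EuclideanSpace.proj (2 : Fin 3) : EuclideanSpace ℝ (Fin 3) →L[ℝ] ℝ) x from rfl,
      ContinuousLinearMap.fderiv]
    rfl
  have hs : DifferentiableAt ℝ (fun x : EuclideanSpace ℝ (Fin 3) => B (‖x‖ ^ 2) * x 2) y :=
    (differentiableAt_radial'' hB y).mul hπd
  have hsf : ∀ v, fderiv ℝ (fun x : EuclideanSpace ℝ (Fin 3) => B (‖x‖ ^ 2) * x 2) y v =
      deriv B (‖y‖ ^ 2) * (2 * ⟪y, v⟫) * y 2 + B (‖y‖ ^ 2) * v 2 := fun v => by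
    rw [fderiv_fun_mul (differentiableAt_radial'' hB y) hπd]
    simp only [_root_.add_apply, _root_.smul_apply, smul_eq_mul, fderiv_radial_apply'' hB, hπf]
    ring
  have h1 : DifferentiableAt ℝ (fun x : EuclideanSpace ℝ (Fin 3) =>
      A (‖x‖ ^ 2) • (axis 2 : EuclideanSpace ℝ (Fin 3))) y :=
    (differentiableAt_radial'' hA y).smul_const _
  have h2 : DifferentiableAt ℝ (fun x : EuclideanSpace ℝ (Fin 3) => (B (‖x‖ ^ 2) * x 2) • x) y :=
    hs.smul differentiableAt_fun_id
  rw [fderiv_fun_add h1 h2, fderiv_fun_smul (differentiableAt_radial'' hA y)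
      (differentiableAt_const _), fderiv_fun_smul hs differentiableAt_fun_id]
  simp only [_root_.add_apply, _root_.smul_apply, ContinuousLinearMap.smulRight_apply,
    fderiv_radial_apply'' hA, hsf, fderiv_fun_const, Pi.zero_apply, smul_zero, zero_add,
    fderiv_fun_id, ContinuousLinearMap.coe_id', id]
  abel

/-- The roll field is differentiable. [folklore] -/
theorem differentiable_roll (hA : Differentiable ℝ A) (hB : Differentiable ℝ B) :
    Differentiable ℝ fun x : EuclideanSpace ℝ (Fin 3) =>
      A (‖x‖ ^ 2) • (axis 2 : EuclideanSpace ℝ (Fin 3)) + (B (‖x‖ ^ 2) * x 2) • x := fun y =>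
  ((differentiableAt_radial'' hA y).smul_const _).add
    (((differentiableAt_radial'' hB y).mul
      (EuclideanSpace.proj (2 : Fin 3) : EuclideanSpace ℝ (Fin 3) →L[ℝ] ℝ).differentiableAt).smul
      differentiableAt_fun_id)

/-- **The roll field is ZONAL**: `J₃R = 0` for `R = A(‖y‖²)e₃ + B(‖y‖²)y₂·y`. [folklore] -/
theorem angGen_two_roll (hA : Differentiable ℝ A) (hB : Differentiable ℝ B)
    (y : EuclideanSpace ℝ (Fin 3)) :
    angGen 2 (fun x : EuclideanSpace ℝ (Fin 3) =>
      A (‖x‖ ^ 2) • (axis 2 : EuclideanSpace ℝ (Fin 3)) + (B (‖x‖ ^ 2) * x 2) • x) y = 0 := by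
  rw [angGen_eq]
  simp only [crossCLM_apply, fderiv_roll_apply hA hB, inner_self_cross_axis,
    cross_axis_two_apply_two, cross_axis_add, cross_axis_smul, cross_axis_self, mul_zero, zero_mul,
    zero_add, add_zero, zero_smul, smul_zero, sub_self]

/-! ## §3 LIFT-UP and the roll self-advection -/

/-- **LIFT-UP (roll × streak).** For the zonal swirl `V(y) = Ω(‖y‖²)e₃ × y` and the roll field
`R(y) = A(‖y‖²)e₃ + B(‖y‖²)y₂·y` (all profiles differentiable):
`(V·∇)R(y) + (R·∇)V(y) = 2y₂·(Ω(‖y‖²)B(‖y‖²) + Ω′(‖y‖²)(A(‖y‖²) + B(‖y‖²)‖y‖²))·e₃ × y` —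
the `j = 2` toroidal zonal harmonic `y₂·e₃ × y` (differential rotation): rolls redistribute the
streak. [folklore] -/
theorem roll_streak_liftUp (hΩ : Differentiable ℝ Ω) (hA : Differentiable ℝ A)
    (hB : Differentiable ℝ B) (y : EuclideanSpace ℝ (Fin 3)) :
    convect (fun x : EuclideanSpace ℝ (Fin 3) => Ω (‖x‖ ^ 2) • cross (axis 2) x)
        (fun x : EuclideanSpace ℝ (Fin 3) =>
          A (‖x‖ ^ 2) • (axis 2 : EuclideanSpace ℝ (Fin 3)) + (B (‖x‖ ^ 2) * x 2) • x) y +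
      convect (fun x : EuclideanSpace ℝ (Fin 3) =>
          A (‖x‖ ^ 2) • (axis 2 : EuclideanSpace ℝ (Fin 3)) + (B (‖x‖ ^ 2) * x 2) • x)
        (fun x : EuclideanSpace ℝ (Fin 3) => Ω (‖x‖ ^ 2) • cross (axis 2) x) y =
      (2 * y 2 * (Ω (‖y‖ ^ 2) * B (‖y‖ ^ 2) +
          deriv Ω (‖y‖ ^ 2) * (A (‖y‖ ^ 2) + B (‖y‖ ^ 2) * ‖y‖ ^ 2))) • cross (axis 2) y := by
  rw [swirl_wave_coupling hΩ, angGen_two_roll hA hB]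
  simp only [sub_zero, cross_axis_add, cross_axis_smul, cross_axis_self, smul_zero, zero_add,
    inner_add_right, inner_smul_right, inner_axis_two, real_inner_self_eq_norm_sq]
  module

/-- **Roll self-advection.** For `R(y) = A(‖y‖²)e₃ + B(‖y‖²)y₂·y`:
`(R·∇)R(y) = y₂(2A′(A + B‖y‖²) + AB)·e₃ + (2B′y₂²(A + B‖y‖²) + AB + 2B²y₂²)·y`
(profiles at `‖y‖²`) — zonal and poloidal. [folklore] -/
theorem roll_selfAdvection (hA : Differentiable ℝ A) (hB : Differentiable ℝ B)
    (y : EuclideanSpace ℝ (Fin 3)) :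
    convect (fun x : EuclideanSpace ℝ (Fin 3) =>
          A (‖x‖ ^ 2) • (axis 2 : EuclideanSpace ℝ (Fin 3)) + (B (‖x‖ ^ 2) * x 2) • x)
        (fun x : EuclideanSpace ℝ (Fin 3) =>
          A (‖x‖ ^ 2) • (axis 2 : EuclideanSpace ℝ (Fin 3)) + (B (‖x‖ ^ 2) * x 2) • x) y =
      (y 2 * (2 * deriv A (‖y‖ ^ 2) * (A (‖y‖ ^ 2) + B (‖y‖ ^ 2) * ‖y‖ ^ 2) +
          A (‖y‖ ^ 2) * B (‖y‖ ^ 2))) • (axis 2 : EuclideanSpace ℝ (Fin 3)) +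
        (2 * deriv B (‖y‖ ^ 2) * (y 2) ^ 2 * (A (‖y‖ ^ 2) + B (‖y‖ ^ 2) * ‖y‖ ^ 2) +
          A (‖y‖ ^ 2) * B (‖y‖ ^ 2) + 2 * B (‖y‖ ^ 2) ^ 2 * (y 2) ^ 2) • y := by
  rw [convect_apply, fderiv_roll_apply hA hB]
  simp only [inner_add_right, inner_smul_right, inner_axis_two, real_inner_self_eq_norm_sq,
    PiLp.add_apply, PiLp.smul_apply, smul_eq_mul, axis_two_apply_two, smul_add, smul_smul]
  module

end Summit.NavierStokesRegularity.AngularGalerkinLadderZonalRollStreakLetters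

end
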